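import Summits.QuantumFields.YangMills.Theorems.UnitScaleTiltHalvingHSiteRowsOfSocketsBaseTGammaR
import Summits.QuantumFields.YangMills.Theorems.UnitScaleTiltHalvingHSiteTorusSocketBase
import Summits.QuantumFields.YangMills.Theorems.UnitScaleTiltHalvingHSupURhoWindowsRho3
import Summits.QuantumFields.YangMills.Theorems.UnitScaleTiltHalvingHSupURhoWindowsGamma
import Summits.QuantumFields.YangMills.Theorems.UnitScaleTiltHalvingHSiteH42WindowsOfHw
import Summits.QuantumFields.YangMills.Theorems.UnitScaleTiltHalvingHSiteHtopOfMember
import Summits.QuantumFields.YangMills.Theorems.UnitScaleTiltHalvingH59GammaDischargeFlatRho5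
import Summits.QuantumFields.YangMills.Theorems.UnitScaleTiltHalvingSLetTauFlatCubeMember
import HarnessLib

/-!
# Route `UnitScaleTilt`, crux K1 child «MinimiserStabilityRegPr» (stmt-QuantumFields-19200), registered stub `stub_halvingStep` (v10 `BirthV10`) —
# **PACK-BASE v9 (successor LEAD-H ★w5-19200 g7 H-NAMER WORDS 12∕14∕15, socket (S9); ★★OWNER RULING g28-№14): THE BASE PACK `PACK₅(K − n = 1)` WITH EVERY [4]∕(1.59) ROW
# DISCHARGED BY KERNEL — displayed `hSockets₁ := ∀ L, Odd L → 1 < L → ∀ (B₀ B₀'H B₂' BG BR cB9), signs → ∃ (Cθ : ℝ) (sx ρ₅ : ℕ), 0 ≤ Cθ ∧ ∀ M′ ≥ 1, L^(sx+1) ∣ M′ → ⟨H42topCrossT⟩` ONLY.**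
The re-letter of ✓p690206 `HalvingHMemberPackBaseOfSocketsR5.memberPack_base_of_socketsρ5` (ρ6 socket edition (S1)): the [Balaban1985BackgroundPropagators] Thm 3.1 letters `SLetτL` at `U₀ = 1`
are a THEOREM on print's p. 98 sub-lattice — px9 g5 ✓`HalvingSLetTauFlatCubeMember.SLetτL_holds_member` (LOCATE (L-A); lit ✓`prop6_real123_printed` ∘ ✓`flatLettersRD_of_real_tau`) with exactly
the ρ5 antecedents `L^(sx+1) ∣ M′`, `L^(sx+1) ∣ ρ′`, `ρ₅ ≤ ρ′` — so the pack FEEDS it to the k = 1 composer at the member (G1: the socket's free `a ρ′` instantiated at the member, `ρ′ := ρ+M+L+S`,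
`ρ₅ ≤ ρ ≤ ρ′`), exactly as ✓p690206 feeds px10 g3's ✓`H59TLγ5_holds_member` for the (1.59) row; the socket (S9) is read at the THEOREMS' constants (`B₀'H B₂' BG BR` := px9's, `B₀ := Bbd :=` px10's
floor `Bs`, any `cB9 > 0`), `sx ρ₅ := max` of the three letter pairs; conclusion `PACK₅` UNCHANGED (= ym-ust-20520-w5 g9's `hPack₁`).  INSIDE otherwise = ✓p690206 VERBATIM: composer
✓`HalvingHSiteRowsOfSocketsBaseTGammaR.siteRows_of_sockets_baseTγR` (v3.2) at `t₀ := 0`; windows via ✓`exists_topCall_constants_of_rhoWindow₃` ∕ ✓`gammaWindows_of_hw … (Z := 1 + cB9⁻¹)` ∕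
✓`h42Windows_base_of_hw`; `HTOP` via ✓`htopSocket_of_member`; torus via ✓`hTorus_base_of_windows`.  THE ONE DISPLAYED ROW: `⟨H42topCrossT v3.2⟩` (Prop. 3 (1.42) on the level-`k` collar bonds
`cubeLamBP′ ∖ cubeLamB`, DATUM-CLOSED, under the ρ5 member prefix with `Cθ·(ρ′+M′+1) ≤ Cr`; print's mechanism = (1.29)@(k−1), the «mixed-end top (1.42)» (M2′)+(N1), OPEN — its discharge
(v10) uses `hCθ` and is constant-robust, whence the ∀-quantification over the constants).

Cell `ym3-torus` (HUMAN RULING D-0037, YM ladder rung R3 — YM₃ on T³ is a RUNG, NOT d = 4, NOT the Clay problem; the YM mass gap is NOT proved here or anywhere in this file), width seat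
`ym3-torus-px20` gen 4.  `--supports stmt-QuantumFields-19200 --as helper`; count-neutral; def-free, 0 sorry, standard axioms; nothing here claims the displayed socket, the stub, the crux, the rung
or the gap.  A6 (WORD 29 GUARD): `⟨H42topCrossT v3.2⟩` at `U = 1, gJ = 1, u₁ = 1, λ′ = 0, u = 1, V′ = 1, A′ = 0` (the three ρ5 antecedents are hypotheses there).
References: Bałaban, CMP **99** 75–102 [Balaban1985RegularSpaces] Prop. 3 pp.82–83, (1.59) p.86, Thm 4 p.88, p.98; CMP **99** 389–434 [Balaban1985BackgroundPropagators] Thm 3.1∕3.3; CMP **102** [Balaban1985Variational] (150)–(156).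
-/

set_option autoImplicit false
noncomputable section
open scoped BigOperators Matrix.Norms.L2Operator
open NormedSpace open Complex (I)
namespace Summit.QuantumFields.YangMills.Theorems.HalvingHMemberPackBaseOfSocketsR9
open Literature.MathematicalPhysics.QuantumFieldTheory.Balaban1983to89
open Literature.MathematicalPhysics.QuantumFieldTheory.Balaban1983to89.T3ContinuumYM3Torus
open Literature.MathematicalPhysics.QuantumFieldTheory.Balaban1983to89.T3PrintedRegularMinimiser (RegPr regFibrePr mem_regFibrePr_iff)
open T4Continuum open MatrixLog (mlog) open B5Eq118OneStroke (iterBlockOf) open B7Prop1Explicit (e expUnit l1) open B7Prop1Explicit renaming Site → LSite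
open B7Prop2Explicit (unitaryUnits C0 c2' avgIter) open B7Prop3Flat (c3) open B7Prop10General (C6 C4G) open B7Prop9Flat (C5') open B7Prop1Local (InBox loK bondHiK)
open B7Eq78Linearization (conjR zdBlocking QprimeIter Rbar_zero) open B7Eq92Concrete (mgauge mgauge_apply) open B8Ineq130 (tlo thi) open B8Ineq132 (covDerivFwd InAk BondTouches)
open B8Eq119TwistedAxial (Restr129 InAx bgT) open B8Eq131Cubes (cube gs tLo tHi) open B8Eq131CubesAdmissible (cubeFam cubeFam_false_of_le) open B8CubeMemberZd (cubeLamS cubeLamB)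
open B8Eq184Proof (gaugeExp cfgExp) open B8Eq182Proof (gAd) open B8Eq188Proof (frakF3) open B8Eq140Level (SideTouches) open B8Eq146AExpansion (iEta)
open B8Eq138LandauZd (IsLandau138W covDivB covLap QT logCfg) open B7Prop4GeneralLevels (logCovIter linCovIter) open B8Eq155JBound (Jcur wsup) open B8ScaledSupNorm (bondNorm msup)
open B8Eq1117Concrete (XSpace) open B8Prop5ContractionKLevel (Bd2 Mc Kc) open B8LambdaSpaceKLevel (wt) open B8Eq178Averages (Qnl)
open B8SpecialUnitaryTrace (trCLM trCLM_apply trCLM_mul_comm) open B10Eq27TorusAxialLog (transl rel pull pull_apply unitsField toUField suIncl gaugeActT axialT unitsField_mem_unitaryUnits)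
open B15Eq112TorusCover (lift cover) open Node00 (coverAt) open LatticeFieldCalculus (siteAvgIter) open Summit.QuantumFields.YangMills.Theorems.Prop8ChartDoubleBar (dbarIterU vframeU)
open Summit.QuantumFields.YangMills.Theorems (FlatMinimizerH.le_T3) open HalvingHSiteTopKnit (hknit_of_descent) open P1FlatCoreCubeInclusion (corner_of_offset room_of_level_k)
open HalvingP1FlatCoreSupplierAssembly (hc₁_of_small) open HalvingHSiteRowsOfSocketsBaseTGammaR (siteRows_of_sockets_baseTγR) open HalvingHSiteTorusSocketBase (hTorus_base_of_windows)
open HalvingHSupURhoWindowsRho3 (exists_topCall_constants_of_rhoWindow₃) open HalvingHSiteH42WindowsOfHw (h42Windows_base_of_hw) open HalvingHSiteHtopOfMember (htopSocket_of_member)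
open HalvingHSupURhoWindowsGamma (gammaWindows_of_hw) open B9SupplySockB9P3ZdBeta (CrossB) open B9SupplySockB9P3ZdGamma (cubeLamBP') open B8Lemma1NonAbelian (lowPart) open HalvingH59GammaDischargeFlatRho5 (H59TLγ5_holds_member)
open HalvingSLetTauFlatCubeMember (SLetτL_holds_member)

/-- ★★★ **THE BASE PACK, v9 SOCKET (S9), PACK₅ CURRENCY — THE [4] LETTERS `SLetτL` AND THE (1.59) ROW BOTH DISCHARGED IN-PACK; ONLY `⟨H42topCrossT⟩` DISPLAYED.**  See the module docstring: per `L` the constants `B₀`, `Cw :=` the window hand's factor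
(unchanged from ✓p672054), `Mₚ := 1`, `Cθ` from the socket block, `sx ρ₅ := max` of the socket's and ✓`H59TLγ5_holds_member`'s; per `M′ ≥ 1` and member with `K − n = 1`: ✓`siteRows_of_sockets_baseTγR` at `t₀ := 0` with its old windows from `hw` (✓p655819 bridge), its γ windows
from ✓`gammaWindows_of_hw` (same `hw`, `Z := 1 + cB9⁻¹`), the six (1.42)-top windows from ✓`h42Windows_base_of_hw`, `HTOP` from ✓`htopSocket_of_member`, `H59γ` from the displayed
the (1.59) theorem ✓`H59TLγ5_holds_member` at `Bbd := Bs`, the collar residual from the displayed `⟨H42topCrossT⟩`, the torus socket from ✓`hTorus_base_of_windows`; conclusion = `PACK₅` (LEAD-H g7 WORD 3 (T4)) — the ρ5 `hPack₁`.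
[cite: Balaban1985RegularSpaces, Prop. 3 (1.36)-(1.42) pp.82-83, (1.59) p.86, Thm 4 p.88; Balaban1985BackgroundPropagators, Thm 3.1 p.397, Thm 3.3 p.399; Balaban1985Variational, (150)-(156) pp.301-302] -/
theorem memberPack_base_of_socketsρ9
    (hSockets₁ : ∀ L : ℕ, Odd L → 1 < L → ∀ (B₀ B₀'H B₂' BG BR cB9 : ℝ), 0 < B₀ → 0 < B₀'H → 0 ≤ B₂' → 0 ≤ BG → 0 ≤ BR → 0 < cB9 →
        -- socket (S9): for EVERY choice of the [4]∕(1.59) constants, the (M2′) window constant `Cθ ≥ 0`, the p.98 letters `sx ρ₅`, ONE `∀ M′` binder, and ONLY the collar residual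
        ∃ (Cθ : ℝ) (sx ρ₅ : ℕ), 0 ≤ Cθ ∧ ∀ (M' : ℕ), 1 ≤ M' → L ^ (sx + 1) ∣ M' →
        -- `H42topCrossT`: Prop. 3 (1.42) at the level-`K − n` COLLAR bonds `cubeLamBP′ … ∖ cubeLamB …`, DATUM-CLOSED (∀ over Theorem 4's datum `(gJ u₁ W A c₁ c′ κf λ′)` with J3's guards, `HTOP`'s antecedents and the (1.108) sizes; knit at the datum's own `g′₀` on ALL `cubeLamBP′` boxes — ★w3-19200 g9 v3.1, LEAD-H WORD 29), under the same prefix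
        (∀ (F : T3Family), F.L = L → ∀ (n K : ℕ) (hnK : n < K) (ρ S M ρ' : ℕ), ρ' = ρ + M + L + S → 1 ≤ M → 2 ≤ S → ∀ (a₅ Cr ε₀ ε₁ : ℝ), 0 < Cr → 4 < Cr → 12 * ((ρ : ℝ) + (M : ℝ)) * a₅ ≤ Cr →
          Cθ * ((((ρ + M + L + S : ℕ) : ℝ) + (M' : ℝ) + 1)) ≤ Cr → L ^ (sx + 1) ∣ ρ + M + L + S → ρ₅ ≤ ρ → 0 < ε₁ → 0 < ε₀ → ε₀ ≤ a₅ → Cr * ε₁ ≤ ε₀ →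
          (10 : ℝ) ^ 29 * (L : ℝ) ^ 12 * (1 + B₀ + B₀⁻¹) ^ 2 * ((1 + B₀'H) * (1 + B₂') * (1 + BG) * (1 + BR)) ^ 5 * (1 + cB9⁻¹) * ((((ρ + M + L + S : ℕ) : ℝ) + (M' : ℝ) + 1) ^ 3 * ε₀) ≤ 1 →
          2 * ρ + (M' + 1 + 2 * (M + L + S)) ≤ F.L ^ (F.m + n) → ∀ (V : GaugeField (F.P n) 0 (Matrix.specialUnitaryGroup (Fin 2) ℂ)), PlaqSmall ε₁ V → ∀ U ∈ regFibrePr F n K hnK.le ε₀ V,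
          ∀ (x₀ : Site (F.P K) 0) (t : ℤ), 0 ≤ t → t ≤ (M' : ℤ) - 1 → ∀ (a : LSite (F.P K).d), a = (fun μ => ((iterBlockOf (K - n) x₀ μ).val : ℤ) - t) →
          ∀ (α₁ α₄ cstar : ℝ), α₁ = 198 * (((ρ' : ℝ) + M' + 1) * ε₀) + 27 * (((ρ' : ℝ) + M' + 1) * ε₀) / ((L : ℝ) * B₀) → cstar = 5 * (F.P K).d * (F.P K).L * B₀ * (ε₀ + α₁) →
          α₄ = 8 * (300 * (L : ℝ) * ((3 * (M' + ρ') + 1 : ℕ) : ℝ) * (B₀'H + 15 * (L : ℝ) ^ 2 * BG * BR + 3 * BG * BR * B₂')) * (5 * ((3 : ℕ) : ℝ) * L * B₀) * (ε₀ + α₁) → ∀ (s : ℝ), s = (198 + 12 * (((M' : ℝ) - 1) + 4 * ρ')) * ε₀ →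
          ∀ (gJ : GaugeTransf (F.P K) 0 (Matrix.specialUnitaryGroup (Fin 2) ℂ)) (u₁ : LSite (F.P K).d → (Matrix (Fin 2) (Fin 2) ℂ)ˣ)
          (W : LSite (F.P K).d → Fin (F.P K).d → (Matrix (Fin 2) (Fin 2) ℂ)ˣ) (A : LSite (F.P K).d → Fin (F.P K).d → Matrix (Fin 2) (Fin 2) ℂ) (c₁ c' : ℝ)
          (κf : (Site (F.P K) 0 → Matrix (Fin 2) (Fin 2) ℂ) → (i : ℕ) → GaugeTransf (F.P K) i (Matrix (Fin 2) (Fin 2) ℂ)ˣ) (lam : LSite (F.P K).d → Matrix (Fin 2) (Fin 2) ℂ),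
          InAk (F.P K).L (K - n) (((F.L : ℝ)⁻¹) ^ (K - n)) ε₀ (fun _ => (Set.univ : Set (LSite (F.P K).d))) (pull (unitsField (toUField (GaugeField.gaugeAct gJ U))) 0) →
          (∀ m', m' ≤ K - n → ∀ Λ : ℕ → Set (LSite (F.P K).d), InAx (F.P K).L m' Λ (1 : LSite (F.P K).d → Fin (F.P K).d → (Matrix (Fin 2) (Fin 2) ℂ)ˣ) (pull (unitsField (toUField (GaugeField.gaugeAct gJ U))) 0)) →
          (∀ m', m' ≤ K - n → ∀ (x : LSite (F.P K).d) (ν : Fin (F.P K).d), tlo (F.P K).L (tLo a ρ') m' ≤ x → x + e ν ≤ thi (F.P K).L (tHi a M' ρ') m' →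
          ‖((avgIter (F.P K).L (pull (unitsField (toUField (GaugeField.gaugeAct gJ U))) 0) (K - n - m') x ν : (Matrix (Fin 2) (Fin 2) ℂ)ˣ) : Matrix (Fin 2) (Fin 2) ℂ) - 1‖ < s) →
          (∀ (x : LSite (F.P K).d) (ν : Fin (F.P K).d), tLo a ρ' ≤ x → x + e ν ≤ tHi a M' ρ' → lowPart ν (x - tLo a ρ') = 0 →
          avgIter (F.P K).L (pull (unitsField (toUField (GaugeField.gaugeAct gJ U))) 0) (K - n) x ν = 1) →
          (∀ z, ((u₁ z : (Matrix (Fin 2) (Fin 2) ℂ)ˣ) : Matrix (Fin 2) (Fin 2) ℂ) ∈ Matrix.specialUnitaryGroup (Fin 2) ℂ) →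
          mgauge (1 : LSite (F.P K).d → Fin (F.P K).d → (Matrix (Fin 2) (Fin 2) ℂ)ˣ) u₁ W = pull (unitsField (toUField (GaugeField.gaugeAct gJ U))) 0 →
          0 ≤ c' → 8 * 3800 * ((((F.P K).d + 2) * (F.P K).L : ℕ) : ℝ) ^ 2 * c' ≤ 1 → Real.exp c₁ - 1 ≤ ((F.L : ℝ)⁻¹) ^ (K - n) * c' →
          (∀ z ∈ cube (F.P K).L a M' ρ' (K - n) (K - n), ∀ ν : Fin (F.P K).d, W z ν = cfgExp (((F.L : ℝ)⁻¹) ^ (K - n)) A z ν ∧ ((F.L : ℝ)⁻¹) ^ (K - n) * ‖A z ν‖ ≤ c₁) →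
          (∀ (m : Site (F.P K) 0 → Matrix (Fin 2) (Fin 2) ℂ) (i : ℕ) (y : Site (F.P K) (i + 1)), κf m (i + 1) y = (vframeU (gaugeActT (κf m i) (dbarIterU i (gaugeActT
          (fun s => (u₁ (lift (F.P K) x₀ + rel x₀ s))⁻¹ * Unitary.toUnits (suIncl (gJ s)) : GaugeTransf (F.P K) 0 (Matrix (Fin 2) (Fin 2) ℂ)ˣ)
          (unitsField (toUField U))))) y)⁻¹ * κf m i (emb y) * vframeU (dbarIterU i (gaugeActT
          (fun s => (u₁ (lift (F.P K) x₀ + rel x₀ s))⁻¹ * Unitary.toUnits (suIncl (gJ s)) : GaugeTransf (F.P K) 0 (Matrix (Fin 2) (Fin 2) ℂ)ˣ) (unitsField (toUField U)))) y) →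
          (∀ (m : Site (F.P K) 0 → Matrix (Fin 2) (Fin 2) ℂ) (x : Site (F.P K) 0), ((κf m 0 x : (Matrix (Fin 2) (Fin 2) ℂ)ˣ) : Matrix (Fin 2) (Fin 2) ℂ) = exp (m x)) →
          (∀ x, IsSelfAdjoint (lam x)) → (∀ x, (lam x).trace = 0) → (∀ yc ∈ cubeLamS (F.P K).L a M' ρ' (K - n) (K - n) (K - n),
          κf (((-I) • lam) ∘ fun s : Site (F.P K) 0 => lift (F.P K) x₀ + rel x₀ s) (K - n) (coverAt (F.P K) (K - n) yc) = axialT (dbarIterU (K - n) (gaugeActT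
          (fun s => (u₁ (lift (F.P K) x₀ + rel x₀ s))⁻¹ * Unitary.toUnits (suIncl (gJ s)) : GaugeTransf (F.P K) 0 (Matrix (Fin 2) (Fin 2) ℂ)ˣ)
          (unitsField (toUField U)))) (iterBlockOf (K - n) x₀) (coverAt (F.P K) (K - n) yc)) →
          (∀ j, j ≤ K - n → ∀ b ∈ {b : LSite (F.P K).d × Fin (F.P K).d | SideTouches ((cubeFam false (F.P K).L a M' ρ' (K - n)) j) b.1 b.2},
          ‖lam b.1‖ ≤ α₄ ∧ wt (F.P K).L (((F.L : ℝ)⁻¹) ^ (K - n)) j * ‖covDerivFwd (((F.L : ℝ)⁻¹) ^ (K - n)) (1 : LSite (F.P K).d → Fin (F.P K).d → (Matrix (Fin 2) (Fin 2) ℂ)ˣ) b.2 lam b.1‖ ≤ α₄) →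
          Restr129 (F.P K).L (K - n) (cubeLamS (F.P K).L a M' ρ' (K - n) (K - n)) (1 : LSite (F.P K).d → Fin (F.P K).d → (Matrix (Fin 2) (Fin 2) ℂ)ˣ) u₁ →
          Restr129 (F.P K).L (K - n) (Function.update (cubeLamS (F.P K).L a M' ρ' (K - n) (K - n)) (K - n) ∅) (1 : LSite (F.P K).d → Fin (F.P K).d → (Matrix (Fin 2) (Fin 2) ℂ)ˣ) (u₁ * gaugeExp lam) →
          ∀ (u : LSite (F.P K).d → (Matrix (Fin 2) (Fin 2) ℂ)ˣ) (V' : LSite (F.P K).d → Fin (F.P K).d → (Matrix (Fin 2) (Fin 2) ℂ)ˣ) (A' : LSite (F.P K).d → Fin (F.P K).d → (Matrix (Fin 2) (Fin 2) ℂ)),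
          (∀ x, u x ∈ unitaryUnits (Matrix (Fin 2) (Fin 2) ℂ)) → mgauge (1 : LSite (F.P K).d → Fin (F.P K).d → (Matrix (Fin 2) (Fin 2) ℂ)ˣ) u V' = (pull (unitsField (toUField (GaugeField.gaugeAct gJ U))) 0) →
          Restr129 (F.P K).L (K - n) (Function.update (cubeLamS (F.P K).L a M' ρ' (K - n) (K - n)) (K - n) ∅) (1 : LSite (F.P K).d → Fin (F.P K).d → (Matrix (Fin 2) (Fin 2) ℂ)ˣ) u →
          (IsLandau138W (F.P K).L (K - n) (((F.L : ℝ)⁻¹) ^ (K - n)) ((cubeFam false (F.P K).L a M' ρ' (K - n)) 0) (cubeLamS (F.P K).L a M' ρ' (K - n) (K - n)) (1 : LSite (F.P K).d → Fin (F.P K).d → (Matrix (Fin 2) (Fin 2) ℂ)ˣ) V' ∧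
          (∀ c ∈ (cubeLamBP' (F.P K).L a M' ρ' (K - n) (K - n)) (K - n), ∀ (y : LSite (F.P K).d) (τ : Fin (F.P K).d),
          InBox (loK (F.P K).L (K - n) c.1) (bondHiK (F.P K).L (K - n) c.1 c.2) y → InBox (loK (F.P K).L (K - n) c.1) (bondHiK (F.P K).L (K - n) c.1 c.2) (y + e τ) →
          V' y τ = gaugeActT (fun s => ((u₁ * gaugeExp lam) (lift (F.P K) x₀ + rel x₀ s))⁻¹ * Unitary.toUnits (suIncl (gJ s)) : GaugeTransf (F.P K) 0 (Matrix (Fin 2) (Fin 2) ℂ)ˣ) (unitsField (toUField U)) ⟨cover (F.P K) y, τ⟩)) →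
          (∀ y τ, IsSelfAdjoint (A' y τ)) → (∀ j, j ≤ K - n → ∀ y τ, SideTouches ((cubeFam false (F.P K).L a M' ρ' (K - n)) j) y τ →
          V' y τ = cfgExp (((F.L : ℝ)⁻¹) ^ (K - n)) A' y τ ∧ ‖A' y τ‖ ≤ (2 * ((F.P K).L * cstar) + 8 * α₄) * (((F.P K).L : ℝ) ^ j * (((F.L : ℝ)⁻¹) ^ (K - n)))⁻¹) →
          (∀ y τ, (∀ j, j ≤ K - n → ¬ SideTouches ((cubeFam false (F.P K).L a M' ρ' (K - n)) j) y τ) → A' y τ = 0) →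
          ∀ c ∈ (cubeLamBP' (F.P K).L a M' ρ' (K - n) (K - n)) (K - n), c ∉ (cubeLamB (F.P K).L a M' ρ' (K - n) (K - n)) (K - n) →
          ‖logCovIter (F.P K).L (1 : LSite (F.P K).d → Fin (F.P K).d → (Matrix (Fin 2) (Fin 2) ℂ)ˣ) (iEta (((F.L : ℝ)⁻¹) ^ (K - n)) A') (K - n) c.1 c.2‖ < 2 * (F.P K).d * (F.P K).L * α₁)) :
    ∀ L : ℕ, Odd L → 1 < L → ∃ (B₀ : ℝ) (_ : 0 ≤ B₀) (Cw : ℝ) (_ : 0 < Cw) (Cθ : ℝ) (_ : 0 ≤ Cθ) (Mₚ sx ρ₅ : ℕ),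
      ∀ (M' : ℕ), 1 ≤ M' → L ^ (sx + 1) ∣ M' →
      ∀ (ρ S M : ℕ) (hM : 1 ≤ M), Mₚ ≤ M → 2 ≤ S → ∀ (a Cr : ℝ), 0 < Cr → 4 < Cr → 12 * ((ρ : ℝ) + (M : ℝ)) * a ≤ Cr →
      Cθ * ((((ρ + M + L + S : ℕ) : ℝ) + (M' : ℝ) + 1)) ≤ Cr → L ^ (sx + 1) ∣ ρ + M + L + S → ρ₅ ≤ ρ →
      ∀ (ε₀ ε₁ : ℝ), 0 < ε₁ → 0 < ε₀ → ε₀ ≤ a → Cr * ε₁ ≤ ε₀ →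
      Cw * ((((ρ + M + L + S : ℕ) : ℝ) + (M' : ℝ) + 1) ^ 3 * ε₀) ≤ 1 →
      ∀ (Bsz : ℝ), (2985 * (L : ℝ) * B₀ + 405) * ((((ρ + M + L + S : ℕ) : ℝ) + (M' : ℝ) + 1)) ≤ Bsz →
      ∀ F : T3Family, F.L = L → ∀ (n K : ℕ) (hnK : n < K), K - n = 1 → 2 * ρ + (M' + 1 + 2 * (M + L + S)) ≤ F.L ^ (F.m + n) →
        ∀ V : GaugeField (F.P n) 0 (Matrix.specialUnitaryGroup (Fin 2) ℂ), PlaqSmall ε₁ V →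
          ∀ U ∈ regFibrePr F n K hnK.le ε₀ V, ∀ x₀ : Site (F.P K) 0,
              ∃ (t : ℤ) (_ : 0 ≤ t) (_ : t ≤ (M' : ℤ) - 1)
                (gJ : GaugeTransf (F.P K) 0 (Matrix.specialUnitaryGroup (Fin 2) ℂ))
                (u₁ : LSite (F.P K).d → (Matrix (Fin 2) (Fin 2) ℂ)ˣ)
                (W : LSite (F.P K).d → Fin (F.P K).d → (Matrix (Fin 2) (Fin 2) ℂ)ˣ)
                (A : LSite (F.P K).d → Fin (F.P K).d → Matrix (Fin 2) (Fin 2) ℂ)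
                (c₁ c' : ℝ)
                (κf : (Site (F.P K) 0 → Matrix (Fin 2) (Fin 2) ℂ) → (i : ℕ) → GaugeTransf (F.P K) i (Matrix (Fin 2) (Fin 2) ℂ)ˣ)
                (lam : LSite (F.P K).d → Matrix (Fin 2) (Fin 2) ℂ)
                (α₄ cA : ℝ),
                -- hu₁SU
                (∀ z, ((u₁ z : (Matrix (Fin 2) (Fin 2) ℂ)ˣ) : Matrix (Fin 2) (Fin 2) ℂ) ∈ Matrix.specialUnitaryGroup (Fin 2) ℂ) ∧
                -- hW
                (mgauge (1 : LSite (F.P K).d → Fin (F.P K).d → (Matrix (Fin 2) (Fin 2) ℂ)ˣ) u₁ W = pull (unitsField (toUField (GaugeField.gaugeAct gJ U))) 0) ∧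
                -- hchart₀
                (∀ b ∈ {b : LSite (F.P K).d × Fin (F.P K).d | SideTouches (cubeFam false (F.P K).L (fun μ => ((iterBlockOf (K - n) x₀ μ).val : ℤ) - t) M' (ρ + M + L + S) (K - n) 0) b.1 b.2},
      W b.1 b.2 = cfgExp (((F.L : ℝ)⁻¹) ^ (K - n)) A b.1 b.2) ∧
                -- hc'
                (0 ≤ c') ∧
                -- hbudget
                (8 * 3800 * ((((F.P K).d + 2) * (F.P K).L : ℕ) : ℝ) ^ 2 * c' ≤ 1) ∧
                -- hc₁
                (Real.exp c₁ - 1 ≤ ((F.L : ℝ)⁻¹) ^ (K - n) * c') ∧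
                -- hchartTop
                (∀ z ∈ cube (F.P K).L (fun μ => ((iterBlockOf (K - n) x₀ μ).val : ℤ) - t) M' (ρ + M + L + S) (K - n) (K - n), ∀ ν : Fin (F.P K).d,
      W z ν = cfgExp (((F.L : ℝ)⁻¹) ^ (K - n)) A z ν ∧ ((F.L : ℝ)⁻¹) ^ (K - n) * ‖A z ν‖ ≤ c₁) ∧
                -- hκfs
                (∀ (m : Site (F.P K) 0 → Matrix (Fin 2) (Fin 2) ℂ) (i : ℕ) (y : Site (F.P K) (i + 1)),
      κf m (i + 1) y = (vframeU (gaugeActT (κf m i) (dbarIterU i (gaugeActT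
        (fun s => (u₁ (lift (F.P K) x₀ + rel x₀ s))⁻¹ * Unitary.toUnits (suIncl (gJ s)) : GaugeTransf (F.P K) 0 (Matrix (Fin 2) (Fin 2) ℂ)ˣ)
        (unitsField (toUField U))))) y)⁻¹ * κf m i (emb y) *
        vframeU (dbarIterU i (gaugeActT
          (fun s => (u₁ (lift (F.P K) x₀ + rel x₀ s))⁻¹ * Unitary.toUnits (suIncl (gJ s)) : GaugeTransf (F.P K) 0 (Matrix (Fin 2) (Fin 2) ℂ)ˣ)
          (unitsField (toUField U)))) y) ∧
                -- hκf0
                (∀ (m : Site (F.P K) 0 → Matrix (Fin 2) (Fin 2) ℂ) (x : Site (F.P K) 0), ((κf m 0 x : (Matrix (Fin 2) (Fin 2) ℂ)ˣ) : Matrix (Fin 2) (Fin 2) ℂ) = exp (m x)) ∧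
                -- hα0
                (0 ≤ α₄) ∧
                -- hα
                (α₄ ≤ 1 / 70) ∧
                -- hcA0
                (0 ≤ cA) ∧
                -- hcA
                (cA ≤ 1 / 12) ∧
                -- hsa
                (∀ x, IsSelfAdjoint (lam x)) ∧
                -- htr
                (∀ x, (lam x).trace = 0) ∧
                -- hsupp
                (∀ x, x ∉ cubeFam false (F.P K).L (fun μ => ((iterBlockOf (K - n) x₀ μ).val : ℤ) - t) M' (ρ + M + L + S) (K - n) 0 → lam x = 0) ∧
                -- h108₀
                (∀ b ∈ {b : LSite (F.P K).d × Fin (F.P K).d | SideTouches (cubeFam false (F.P K).L (fun μ => ((iterBlockOf (K - n) x₀ μ).val : ℤ) - t) M' (ρ + M + L + S) (K - n) 0) b.1 b.2},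
      ‖lam b.1‖ ≤ α₄ ∧ wt (F.P K).L (((F.L : ℝ)⁻¹) ^ (K - n)) 0 *
        ‖covDerivFwd (((F.L : ℝ)⁻¹) ^ (K - n)) (1 : LSite (F.P K).d → Fin (F.P K).d → (Matrix (Fin 2) (Fin 2) ℂ)ˣ) b.2 lam b.1‖ ≤ α₄) ∧
                -- hmult
                (∃ μ : ℕ → LSite (F.P K).d → Matrix (Fin 2) (Fin 2) ℂ, ∀ x ∈ cubeFam false (F.P K).L (fun μ => ((iterBlockOf (K - n) x₀ μ).val : ℤ) - t) M' (ρ + M + L + S) (K - n) 0,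
      covLap (((F.L : ℝ)⁻¹) ^ (K - n)) (1 : LSite (F.P K).d → Fin (F.P K).d → (Matrix (Fin 2) (Fin 2) ℂ)ˣ)
        ((cubeFam false (F.P K).L (fun μ => ((iterBlockOf (K - n) x₀ μ).val : ℤ) - t) M' (ρ + M + L + S) (K - n) 0).indicator fun y =>
          covDivB (((F.L : ℝ)⁻¹) ^ (K - n)) (1 : LSite (F.P K).d → Fin (F.P K).d → (Matrix (Fin 2) (Fin 2) ℂ)ˣ) A y +
          covLap (((F.L : ℝ)⁻¹) ^ (K - n)) (1 : LSite (F.P K).d → Fin (F.P K).d → (Matrix (Fin 2) (Fin 2) ℂ)ˣ) lam y +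
          ((conjR (gaugeExp lam y)⁻¹ (covDivB (((F.L : ℝ)⁻¹) ^ (K - n)) (1 : LSite (F.P K).d → Fin (F.P K).d → (Matrix (Fin 2) (Fin 2) ℂ)ˣ) A y) -
              covDivB (((F.L : ℝ)⁻¹) ^ (K - n)) (1 : LSite (F.P K).d → Fin (F.P K).d → (Matrix (Fin 2) (Fin 2) ℂ)ˣ) A y) +
            (gAd (covLap (((F.L : ℝ)⁻¹) ^ (K - n)) (1 : LSite (F.P K).d → Fin (F.P K).d → (Matrix (Fin 2) (Fin 2) ℂ)ˣ) lam y) (lam y) -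
              covLap (((F.L : ℝ)⁻¹) ^ (K - n)) (1 : LSite (F.P K).d → Fin (F.P K).d → (Matrix (Fin 2) (Fin 2) ℂ)ˣ) lam y) +
            ∑ μ, frakF3 (((F.L : ℝ)⁻¹) ^ (K - n)) (1 : LSite (F.P K).d → Fin (F.P K).d → (Matrix (Fin 2) (Fin 2) ℂ)ˣ) lam A y μ)) x =
        QT (F.P K).L (K - n) (cubeLamS (F.P K).L (fun μ => ((iterBlockOf (K - n) x₀ μ).val : ℤ) - t) M' (ρ + M + L + S) (K - n) (K - n)) (1 : LSite (F.P K).d → Fin (F.P K).d → (Matrix (Fin 2) (Fin 2) ℂ)ˣ) μ x) ∧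
                -- htopId
                (∀ yc ∈ cubeLamS (F.P K).L (fun μ => ((iterBlockOf (K - n) x₀ μ).val : ℤ) - t) M' (ρ + M + L + S) (K - n) (K - n) (K - n),
      κf (((-I) • lam) ∘ fun s : Site (F.P K) 0 => lift (F.P K) x₀ + rel x₀ s) (K - n) (coverAt (F.P K) (K - n) yc) =
        axialT (dbarIterU (K - n) (gaugeActT
          (fun s => (u₁ (lift (F.P K) x₀ + rel x₀ s))⁻¹ * Unitary.toUnits (suIncl (gJ s)) : GaugeTransf (F.P K) 0 (Matrix (Fin 2) (Fin 2) ℂ)ˣ)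
          (unitsField (toUField U)))) (iterBlockOf (K - n) x₀) (coverAt (F.P K) (K - n) yc)) ∧
                -- hA0
                (∀ x ∈ cubeFam false (F.P K).L (fun μ => ((iterBlockOf (K - n) x₀ μ).val : ℤ) - t) M' (ρ + M + L + S) (K - n) 0, ∀ μ : Fin (F.P K).d,
      wt (F.P K).L (((F.L : ℝ)⁻¹) ^ (K - n)) 0 * ‖A x μ‖ ≤ cA ∧
        wt (F.P K).L (((F.L : ℝ)⁻¹) ^ (K - n)) 0 *
          ‖conjR ((1 : LSite (F.P K).d → Fin (F.P K).d → (Matrix (Fin 2) (Fin 2) ℂ)ˣ) (x - e μ) μ)⁻¹ (A (x - e μ) μ)‖ ≤ cA) ∧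
                -- hX1
                (∀ j, j ≤ K - n → ∀ z ∈ cube (F.P K).L (fun μ => ((iterBlockOf (K - n) x₀ μ).val : ℤ) - t) M' (ρ + M + L + S) (K - n) j, ∀ ν' : Fin (F.P K).d,
      (F.L : ℝ) ^ j * ((F.L : ℝ)⁻¹) ^ (K - n) *
        ‖logCfg (((F.L : ℝ)⁻¹) ^ (K - n)) (mgauge (1 : LSite (F.P K).d → Fin (F.P K).d → (Matrix (Fin 2) (Fin 2) ℂ)ˣ) (gaugeExp lam)⁻¹
          (cfgExp (((F.L : ℝ)⁻¹) ^ (K - n)) A)) z ν'‖ ≤ Bsz * ε₀) ∧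
                -- hX2
                (∀ j, j ≤ K - n → ∀ z ∈ cube (F.P K).L (fun μ => ((iterBlockOf (K - n) x₀ μ).val : ℤ) - t) M' (ρ + M + L + S) (K - n) j, ∀ ν' μ' : Fin (F.P K).d,
      z + e μ' ∈ cube (F.P K).L (fun μ => ((iterBlockOf (K - n) x₀ μ).val : ℤ) - t) M' (ρ + M + L + S) (K - n) 0 →
      ((F.L : ℝ) ^ j * ((F.L : ℝ)⁻¹) ^ (K - n)) ^ 2 * (F.L : ℝ) ^ (K - n) *
        ‖logCfg (((F.L : ℝ)⁻¹) ^ (K - n)) (mgauge (1 : LSite (F.P K).d → Fin (F.P K).d → (Matrix (Fin 2) (Fin 2) ℂ)ˣ) (gaugeExp lam)⁻¹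
            (cfgExp (((F.L : ℝ)⁻¹) ^ (K - n)) A)) (z + e μ') ν' -
          logCfg (((F.L : ℝ)⁻¹) ^ (K - n)) (mgauge (1 : LSite (F.P K).d → Fin (F.P K).d → (Matrix (Fin 2) (Fin 2) ℂ)ˣ) (gaugeExp lam)⁻¹
            (cfgExp (((F.L : ℝ)⁻¹) ^ (K - n)) A)) z ν'‖ ≤ Bsz * ε₀) := by
  intro L hodd hL
  -- ρ6: the (1.59) row is a THEOREM on print's p. 98 sub-lattice (px10 g3 ✓`H59TLγ5_holds_member`); read the sockets above its floor `Bs`, collar constant `Bbd := Bs`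
  obtain ⟨Bs, sxp, ρ₅p, hBs1, HT⟩ := H59TLγ5_holds_member L hL
  -- v9: the [4] letters `SLetτL` are a THEOREM on the p. 98 sub-lattice too (px9 g5 ✓`SLetτL_holds_member`); constants := px9's∕px10's, `B₀ := Bbd :=` the (1.59) floor `Bs`, any `cB9 > 0`
  obtain ⟨B₀'H, B₂', BG, BR, sxτ, ρ₅τ, hB₀'H, hB₂', hBG, hBR, HS⟩ := SLetτL_holds_member L hL
  obtain ⟨B₀, hBsB₀⟩ : ∃ B₀ : ℝ, Bs ≤ B₀ := ⟨Bs, le_rfl⟩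
  obtain ⟨cB9, hcB9⟩ : ∃ c : ℝ, 0 < c := ⟨1, one_pos⟩
  have hB₀ : 0 < B₀ := lt_of_lt_of_le (lt_of_lt_of_le zero_lt_one hBs1) hBsB₀
  obtain ⟨Cθ, sxs, ρ₅s, hCθ0, hrows⟩ := hSockets₁ L hodd hL B₀ B₀'H B₂' BG BR cB9 hB₀ hB₀'H hB₂' hBG hBR hcB9
  refine ⟨B₀, hB₀.le, (10 : ℝ) ^ 29 * (L : ℝ) ^ 12 * (1 + B₀ + B₀⁻¹) ^ 2 * ((1 + B₀'H) * (1 + B₂') * (1 + BG) * (1 + BR)) ^ 5 * (1 + cB9⁻¹), by positivity, Cθ, hCθ0,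
    1, max (max sxs sxp) sxτ, max (max ρ₅s ρ₅p) ρ₅τ,
    fun M' hM' hdvM' ρ S M hM hMₚ hS a₅ Cr hCr hCr4 h12 hCθ hdiv hρ₅ ε₀ ε₁ hε₁ hε₀ hε₀a hCrε hw Bsz hBsz F hF n K hnK hKn hroom V hV U hU x₀ => ?_⟩
  -- the socket's, the (1.59) theorem's and the [4]-letters theorem's sub-lattice letters from the pack's `sx ρ₅ := max (max · ·) ·`
  have hdvM'τ : L ^ (sxτ + 1) ∣ M' := (Nat.pow_dvd_pow L (by omega)).trans hdvM'
  have hdivτ : L ^ (sxτ + 1) ∣ ρ + M + L + S := (Nat.pow_dvd_pow L (by omega)).trans hdiv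
  have hρ₅τ : ρ₅τ ≤ ρ + M + L + S := le_trans ((le_max_right _ _).trans hρ₅) (by omega)
  have hdvM's : L ^ (sxs + 1) ∣ M' := (Nat.pow_dvd_pow L (by omega)).trans hdvM'
  have hdvM'p : L ^ (sxp + 1) ∣ M' := (Nat.pow_dvd_pow L (by omega)).trans hdvM'
  have hdivs : L ^ (sxs + 1) ∣ ρ + M + L + S := (Nat.pow_dvd_pow L (by omega)).trans hdiv
  have hdivp : L ^ (sxp + 1) ∣ ρ + M + L + S := (Nat.pow_dvd_pow L (by omega)).trans hdiv
  have hρ₅s : ρ₅s ≤ ρ := ((le_max_left _ _).trans (le_max_left _ _)).trans hρ₅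
  have hρ₅p : ρ₅p ≤ ρ := ((le_max_right _ _).trans (le_max_left _ _)).trans hρ₅
  have hH42 := hrows M' hM' hdvM's
  classical
  have hL3 : 3 ≤ L := by obtain ⟨r, hr⟩ := hodd; omega
  have hd3 : (F.P K).d = 3 := T3Family.P_d F K
  have hLF : (F.P K).L = F.L := rfl
  have hM'z : (0 : ℤ) ≤ (M' : ℤ) - 1 := by linarith only [show (1 : ℤ) ≤ (M' : ℤ) from by exact_mod_cast hM']
  have hkP : K - n ≤ (F.P K).m + (F.P K).K := FlatMinimizerH.le_T3 F n K
  have hL2P : 2 ≤ (F.P K).L := by rw [hLF, hF]; omega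
  have hLr : ((F.P K).L : ℝ) = (L : ℝ) := by rw [hLF, hF]
  have hLpos : (0 : ℝ) < ((F.P K).L : ℝ) := by rw [hLr]; exact_mod_cast (show 0 < L by omega)
  have hw' := hw
  rw [← hLr] at hw'
  obtain ⟨m₀, α₀, α₁, a₆₆, cstar, B₀', α₄, C₂, cB, cA, cDA, c', σ, δ, ω, Cb, Cl, τ₀, e0, eα₀, ea, e1, ec, eB, e4, eC, ecB, ecA, ecDA, ecp, eσ, hδ, hω, hτ₀,
    ⟨-, -, hα₁, -, hsα₁, ha66lo, -, -, hα₄, -, -, hCb, hCl, -, hcA0, -, -, -, -⟩,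
    ⟨-, -, ha4, h2s, -, -, -, hd5, -, -, hside, h50, -, -⟩,
    ⟨-, -, -, -, hsmall₁, hcBlo, -, -, hsmall, hc₃, hsc, hα₃', hs₁, hs₂, hs₃, hs₄, hs₅, hs₆, -, hprod8, hcA13, -, hCb₀, -, hCl₀, hCbρ, hClB⟩,
    ⟨hα70, hcA12, -, -, -, -, hs6, -, -, hLa2, -, hbudgetσ, hm, hr⟩, hwin⟩ :=
    exists_topCall_constants_of_rhoWindow₃ (F.P K).d (F.P K).L hd3 hL2P hB₀ hB₀'H hB₂' hBG hBR hcB9 M' (ρ + M + L + S) hε₀ hw'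
  subst α₀
  have hM'r : (1 : ℝ) ≤ (M' : ℝ) := by exact_mod_cast hM'
  have hρ'0 : (0 : ℝ) ≤ ((ρ + M + L + S : ℕ) : ℝ) := Nat.cast_nonneg _
  have hX1 : (1 : ℝ) ≤ ((((ρ + M + L + S : ℕ) : ℝ)) + (M' : ℝ) + 1) := by linarith only [hρ'0, hM'r]
  have hsdef : a₆₆ = (198 + 12 * (((M' : ℝ) - 1) + 4 * (ρ + M + L + S : ℕ))) * ε₀ := by rw [ea]; ring
  have hs0 : 0 ≤ a₆₆ := by
    have : 0 ≤ 198 * ε₀ + 12 * ((M' : ℝ) - 1 + 4 * (ρ + M + L + S : ℕ)) * ε₀ := by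
      have h1 : (0 : ℝ) ≤ (M' : ℝ) - 1 + 4 * (ρ + M + L + S : ℕ) := by linarith only [hρ'0, hM'r]
      have h2 : (0 : ℝ) ≤ ((M' : ℝ) - 1 + 4 * (ρ + M + L + S : ℕ)) * ε₀ := mul_nonneg h1 hε₀.le
      linarith only [h2, hε₀.le]
    linarith only [this, ha66lo]
  have hs1 : 2 * a₆₆ ≤ 1 := by linarith only [ha4]
  have hε : 10 ^ 7 * (F.L : ℝ) ^ 3 * ε₀ ≤ 1 := by
    rw [hF]
    have hL1 : (1 : ℝ) ≤ (L : ℝ) := by exact_mod_cast (show 1 ≤ L by omega)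
    have hA : (1 : ℝ) ≤ (1 + B₀ + B₀⁻¹) ^ 2 :=
      one_le_pow₀ (by have := (inv_pos.2 hB₀).le; linarith only [this, hB₀.le])
    have hB : (1 : ℝ) ≤ ((1 + B₀'H) * (1 + B₂') * (1 + BG) * (1 + BR)) ^ 5 := by
      refine one_le_pow₀ ?_
      have a1 : (1 : ℝ) ≤ 1 + B₀'H := by linarith only [hB₀'H.le]
      have a2 : (1 : ℝ) ≤ 1 + B₂' := by linarith only [hB₂']
      have a3 : (1 : ℝ) ≤ 1 + BG := by linarith only [hBG]
      have a4 : (1 : ℝ) ≤ 1 + BR := by linarith only [hBR]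
      exact one_le_mul_of_one_le_of_one_le (one_le_mul_of_one_le_of_one_le (one_le_mul_of_one_le_of_one_le a1 a2) a3) a4
    have hC : (1 : ℝ) ≤ 1 + cB9⁻¹ := by have := (inv_pos.2 hcB9).le; linarith only [this]
    have hX3 : (1 : ℝ) ≤ ((((ρ + M + L + S : ℕ) : ℝ)) + (M' : ℝ) + 1) ^ 3 := one_le_pow₀ hX1
    have h10 : (10 : ℝ) ^ 7 ≤ 10 ^ 29 := by norm_num
    have hL312 : (L : ℝ) ^ 3 ≤ (L : ℝ) ^ 12 := pow_le_pow_right₀ hL1 (by norm_num)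
    calc 10 ^ 7 * (L : ℝ) ^ 3 * ε₀ = 10 ^ 7 * (L : ℝ) ^ 3 * 1 * 1 * 1 * (1 * ε₀) := by ring
      _ ≤ 10 ^ 29 * (L : ℝ) ^ 12 * (1 + B₀ + B₀⁻¹) ^ 2 * ((1 + B₀'H) * (1 + B₂') * (1 + BG) * (1 + BR)) ^ 5 * (1 + cB9⁻¹) *
          (((((ρ + M + L + S : ℕ) : ℝ)) + (M' : ℝ) + 1) ^ 3 * ε₀) := by gcongr
      _ ≤ 1 := hw
  have hL0 : (L : ℝ) ≠ 0 := by exact_mod_cast (show L ≠ 0 by omega)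
  have hB0 : B₀ ≠ 0 := hB₀.ne'
  have ecs : cstar = 15 * (L : ℝ) * B₀ * ε₀ + 2970 * (L : ℝ) * B₀ * (((((ρ + M + L + S : ℕ) : ℝ)) + (M' : ℝ) + 1) * ε₀) + 405 * (((((ρ + M + L + S : ℕ) : ℝ)) + (M' : ℝ) + 1) * ε₀) := by
    rw [ec, e1, hd3, hLr]; push_cast; field_simp; ring
  have hcsB : cstar ≤ Bsz * ε₀ := by
    have h1 : 15 * (L : ℝ) * B₀ * ε₀ ≤ 15 * (L : ℝ) * B₀ * (((((ρ + M + L + S : ℕ) : ℝ)) + (M' : ℝ) + 1) * ε₀) :=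
      mul_le_mul_of_nonneg_left (le_mul_of_one_le_left hε₀.le hX1) (by positivity)
    have h2 : (2985 * (L : ℝ) * B₀ + 405) * ((((ρ + M + L + S : ℕ) : ℝ)) + (M' : ℝ) + 1) * ε₀ ≤ Bsz * ε₀ := mul_le_mul_of_nonneg_right hBsz hε₀.le
    calc cstar = 15 * (L : ℝ) * B₀ * ε₀ + 2970 * (L : ℝ) * B₀ * (((((ρ + M + L + S : ℕ) : ℝ)) + (M' : ℝ) + 1) * ε₀) + 405 * (((((ρ + M + L + S : ℕ) : ℝ)) + (M' : ℝ) + 1) * ε₀) := ecs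
      _ ≤ 15 * (L : ℝ) * B₀ * (((((ρ + M + L + S : ℕ) : ℝ)) + (M' : ℝ) + 1) * ε₀) + 2970 * (L : ℝ) * B₀ * (((((ρ + M + L + S : ℕ) : ℝ)) + (M' : ℝ) + 1) * ε₀) + 405 * (((((ρ + M + L + S : ℕ) : ℝ)) + (M' : ℝ) + 1) * ε₀) := by linarith only [h1]
      _ = (2985 * (L : ℝ) * B₀ + 405) * ((((ρ + M + L + S : ℕ) : ℝ)) + (M' : ℝ) + 1) * ε₀ := by ring
      _ ≤ Bsz * ε₀ := h2
  have h4s : 4 * a₆₆ ≤ cstar := by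
    have hpos : (0 : ℝ) ≤ 15 * (L : ℝ) * B₀ * ε₀ + 2970 * (L : ℝ) * B₀ * (((((ρ + M + L + S : ℕ) : ℝ)) + (M' : ℝ) + 1) * ε₀) := by positivity
    have key : 4 * a₆₆ ≤ 405 * (((((ρ + M + L + S : ℕ) : ℝ)) + (M' : ℝ) + 1) * ε₀) := by
      rw [ea]
      have hM'ε : ε₀ ≤ (M' : ℝ) * ε₀ := le_mul_of_one_le_left hε₀.le hM'r
      have hρε : (0 : ℝ) ≤ ((ρ + M + L + S : ℕ) : ℝ) * ε₀ := mul_nonneg hρ'0 hε₀.le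
      have e : 405 * (((((ρ + M + L + S : ℕ) : ℝ)) + (M' : ℝ) + 1) * ε₀) - 4 * (198 * ε₀ + 12 * ((M' : ℝ) - 1 + 4 * (ρ + M + L + S : ℕ)) * ε₀)
          = 213 * (((ρ + M + L + S : ℕ) : ℝ) * ε₀) + 357 * ((M' : ℝ) * ε₀) - 339 * ε₀ := by ring
      linarith only [e, hM'ε, hρε, hε₀.le]
    linarith only [key, hpos, ecs]
  have hα₁def : α₁ = 198 * (((((ρ + M + L + S : ℕ) : ℝ)) + (M' : ℝ) + 1) * ε₀) + 27 * (((((ρ + M + L + S : ℕ) : ℝ)) + (M' : ℝ) + 1) * ε₀) / ((L : ℝ) * B₀) := by rw [e1, hLr]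
  have hcdef : cstar = 5 * (F.P K).d * (F.P K).L * B₀ * (ε₀ + α₁) := ec
  have hα₄def : α₄ = 8 * (300 * (L : ℝ) * ((3 * (M' + (ρ + M + L + S)) + 1 : ℕ) : ℝ) * (B₀'H + 15 * (L : ℝ) ^ 2 * BG * BR + 3 * BG * BR * B₂')) *
      (5 * ((3 : ℕ) : ℝ) * L * B₀) * (ε₀ + α₁) := by rw [e4, eB, e0, hd3, hLr]
  have hm₀ : (F.P K).d * (M' + (ρ + M + L + S)) ≤ m₀ := by rw [e0, hd3]; omega
  have hcAw : ((F.P K).L : ℝ) * (2 * a₆₆) ≤ cA := by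
    rw [ecA]; exact mul_le_mul_of_nonneg_left h2s hLpos.le
  have hcDAw : 4 * ((F.P K).d : ℝ) * ((F.P K).L : ℝ) ^ 2 * a₆₆ ≤ cDA := by
    rw [ecDA]
    have h0 : (0 : ℝ) ≤ ((F.P K).d : ℝ) * ((F.P K).L : ℝ) ^ 2 := by positivity
    calc 4 * ((F.P K).d : ℝ) * ((F.P K).L : ℝ) ^ 2 * a₆₆ = ((F.P K).d : ℝ) * ((F.P K).L : ℝ) ^ 2 * (4 * a₆₆) := by ring
      _ ≤ ((F.P K).d : ℝ) * ((F.P K).L : ℝ) ^ 2 * cstar := mul_le_mul_of_nonneg_left h4s h0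
  have hbudget : 8 * 3800 * ((((F.P K).d + 2) * (F.P K).L : ℕ) : ℝ) ^ 2 * (2 * (F.P K).L * (2 * a₆₆)) ≤ 1 := by
    have hσ' : 2 * ((F.P K).L : ℝ) * (2 * a₆₆) ≤ σ := by
      rw [eσ]; exact mul_le_mul_of_nonneg_left (by linarith only [h2s, hs0]) (by positivity)
    exact le_trans (mul_le_mul_of_nonneg_left hσ' (by positivity)) hbudgetσ
  have hsσ : a₆₆ ≤ (((F.P K).L : ℝ) ^ (K - n))⁻¹ * σ := by
    rw [hKn, pow_one]
    have hLa : ((F.P K).L : ℝ) * a₆₆ ≤ σ := by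
      have h0 : 0 ≤ ((F.P K).L : ℝ) * a₆₆ := mul_nonneg hLpos.le hs0
      calc ((F.P K).L : ℝ) * a₆₆ ≤ 2 * (((F.P K).L : ℝ) * a₆₆) := by linarith only [h0]
        _ = 2 * (F.P K).L * a₆₆ := by ring
        _ ≤ σ := hLa2
    exact (le_inv_mul_iff₀ hLpos).2 hLa
  have ha := corner_of_offset x₀ (K - n) (M' := M') le_rfl hM'z
  have hsites : (F.P K).sitesPerDir (K - n) = 2 * F.L ^ (F.m + n) := by
    show 2 * F.L ^ (F.m + K - (K - n)) = _
    congr 2; omega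
  have hroomW : 2 * ((F.P K).L ^ (K - n) * (M' + 1) + (ρ + M + L + S) * gs (F.P K).L (K - n)) ≤ (F.P K).sitesPerDir 0 := by
    refine room_of_level_k (P := F.P K) hkP ?_
    rw [hsites, ← hF]; omega
  have hρ'1 : 1 ≤ ρ + M + L + S := by omega
  have hZ1 : (1 : ℝ) ≤ 1 + cB9⁻¹ := by have := (inv_pos.2 hcB9).le; linarith only [this]
  obtain ⟨hα3γ, hα4γ, h16γ, hsmallPγ, hc₃Pγ, hC₂γ, h61γ, -⟩ := gammaWindows_of_hw (F.P K).d (F.P K).L hd3 hL2P M' (ρ + M + L + S) hε₀ hB₀ hB₀'H hB₂' hBG hBR hZ1 e0 e1 ec eB e4 hw'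
  have hBbd : (0 : ℝ) ≤ Bs := zero_le_one.trans hBs1
  have hBdP : 4 * Bs ≤ (((F.P K).d : ℝ) * (F.P K).L - 1) * B₀ := by
    have e : (((F.P K).d : ℝ) * (F.P K).L - 1) = 3 * (L : ℝ) - 1 := by rw [hd3, hLr]; push_cast; ring
    have hL3r : (3 : ℝ) ≤ (L : ℝ) := by exact_mod_cast hL3
    have h8 : (8 : ℝ) ≤ 3 * (L : ℝ) - 1 := by linarith only [hL3r]
    rw [e]; exact le_trans (by linarith only [hBsB₀, hBbd]) (mul_le_mul_of_nonneg_right h8 hB₀.le)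
  obtain ⟨hα₂, hkb, hbudget42, hrW, hr2W, hwinW, hε₁l⟩ :=
    h42Windows_base_of_hw (F.P K).d (F.P K).L hd3 hL2P hKn M' (ρ + M + L + S) hM' hε₀ hB₀ hB₀'H hB₂' hBG hBR hcB9 hsdef e0 e1 ec eB e4
      hCr4 hε₁.le hCrε hw'
  obtain ⟨-, -, -, hbody⟩ := siteRows_of_sockets_baseTγR F L hF hnK hKn ρ S M M' rfl hε₀ hε hsdef hs6 hroom V U hU x₀ le_rfl hM'z rfl
    hα₁ hα₄ hB₀ hB₀'H hB₂' hBG hBR hcdef hα3γ hα4γ h16γ hd5 hsmallPγ hc₃Pγ hside h50 hC₂γ h61γ hcBlo hsmall hc₃ hsc hα₃' hs₁ hs₂ hs₃ hs₄ hs₅ hs₆ hprod8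
    hα70 hcA0 hcA12 hcA13 hcAw hcDAw hCb hCl hCbρ hClB h2s hs1 hbudget hcsB hBbd hBdP
    (HS M' hdvM'τ F hF n K hnK _ (ρ + M + L + S) hdivτ hρ₅τ)
    (HT M' B₀ B₀'H B₂' BG BR cB9 Bs hBsB₀ le_rfl hB₀'H hB₂' hBG hBR hcB9 F hF n K hnK ρ S M _ rfl hdivp hdvM'p hρ₅p hM hS a₅ Cr ε₀ ε₁ hCr hCr4 h12 hε₁ hε₀ hε₀a hCrε hw
      hroom V hV U hU x₀ 0 le_rfl hM'z _ rfl α₁ α₄ cstar hα₁def hcdef hα₄def a₆₆ hsdef)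
    hsα₁ hα₂ hsmall₁ hkb hbudget42 (t := 2 * (((((F.P K).d * (M' + (ρ + M + L + S))) : ℕ) : ℝ) * ε₁)) hrW hr2W (by simpa only [mul_assoc] using hwinW)
    (htopSocket_of_member F hnK x₀ hρ'1 ha hroomW hε₀ hε hε₁.le V hV U hU (by simpa only [mul_assoc] using hε₁l))
    (hH42 F hF n K hnK ρ S M _ rfl hM hS a₅ Cr ε₀ ε₁ hCr hCr4 h12 hCθ hdivs hρ₅s hε₁ hε₀ hε₀a hCrε hw hroom V hV U hU x₀ 0 le_rfl hM'z _ rfl α₁ α₄ cstar hα₁def hcdef hα₄def a₆₆ hsdef)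
    (hTorus_base_of_windows hnK x₀ hρ'1 ha hroomW U hs0 hα₄ hsσ hδ hω hτ₀ hbudgetσ hm hm₀ hr hCb₀ hCl₀ hwin)
  exact ⟨0, le_rfl, hM'z, hbody⟩

end Summit.QuantumFields.YangMills.Theorems.HalvingHMemberPackBaseOfSocketsR9

end
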